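import Literature.Barriers.ValiantsHypothesis.BIJL18MatrixCompletion
import Literature.Computability.AlgebraicComplexity.FlatteningBound

/-!
# Bläser–Ikenmeyer–Jindal–Lysikov 2018, Theorem 18 — PROVED (`BIJL2018_thm18_holds`)

Discharge of the named fact `BIJL2018_thm18` of `BIJL18MatrixCompletion.lean` (val-lit row
BIJL2018-A; M. Bläser, C. Ikenmeyer, G. Jindal, V. Lysikov, *Generalized matrix completion and
algebraic natural proofs*, STOC 2018 / ECCC TR18-064, Thm. 18, "essentially shown by Derksen
[Der14]"): if the slices `A₀, A₁, …, A_m` of the tensor `t = (A₀, A₁, …, A_m)` are linearly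
independent and `rk A₁ = ⋯ = rk A_m = 1`, then `R(t) = CR(t) + m` (tensor rank = completion rank
plus `m`), [cite: BlaserIkenmeyerJindalLysikov2018, Thm. 18].

The print gives no proof ("The proof uses the well-known fact that if a slice of a tensor `t` has
rank-one, then we can use this slice in an optimal decomposition of `t` into rank-one tensors",
ECCC p. 12). The proof formalised here is elementary linear algebra:

* `R(t) ≤ CR(t) + m` (`tensorRank_slicesTensor_le`; the half that uses `rk A_k = 1`, and the
  argument printed for Prop. 19): with `λ` attaining `CR(t) = rk(A₀ + Σ λ_k A_k)`,
  `t = e₀ ⊗ (A₀ + Σ λ_k A_k) + Σ_k (e_k - λ_k e₀) ⊗ A_k`, and a rank-`r` matrix is a sum of `r`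
  rank-one matrices (`BIJL2018_obs15`).
* `CR(t) + m ≤ R(t)` (`completionRank_add_le_tensorRank`; this half uses only the linear
  independence of the slices): take an optimal decomposition `t = Σ_{l<R} w_l ⊗ u_l ⊗ v_l`
  (`exists_triad_decomposition_tensorRank`). The first-factor vectors `w_l ∈ K^{m+1}` span
  `K^{m+1}` — a linear form killing all `w_l` would give a linear relation among the slices
  `A_o = Σ_l w_l(o) · u_l ⊗ v_l`. Pick `m + 1` of them forming a basis; one of the dual-basis
  forms `π` has `π(e₀) ≠ 0`, normalise to `π(e₀) = 1` and put `λ_k = π(e_k)`: then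
  `A₀ + Σ λ_k A_k = Σ_l π(w_l) · u_l ⊗ v_l` has at most `R - m` nonzero terms, so
  `CR(t) ≤ R - m`.

Theorem-only file (no definitions). Honest framing: a discharge of typed literature (net debt −1);
VP ≠ VNP is NOT proved and nothing here is progress on it.

## References
* [BlaserIkenmeyerJindalLysikov2018] M. Bläser, C. Ikenmeyer, G. Jindal, V. Lysikov, STOC 2018,
  doi:10.1145/3188745.3188832; ECCC TR18-064, §4, Thm. 18 and Prop. 19 (p. 12–13).
* [Derksen2016] H. Derksen, *On the nuclear norm and the singular value decomposition of tensors*,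
  Found. Comput. Math. 16 (2016) — the source BIJL cite as [Der14] (cited through BIJL).
-/

noncomputable section

open scoped BigOperators

namespace Literature.Barriers.ValiantsHypothesis

open Literature.Computability.AlgebraicComplexity Matrix

universe u

variable {K : Type u} [Field K]

namespace Theorem18

/-! ### Rank of a short sum of rank-one matrices -/

/-- A sum of `|σ|` scaled outer products has rank `≤ |σ|` (it factors through `K^σ`).
[cite: BlaserIkenmeyerJindalLysikov2018, Obs. 15] -/
theorem rank_sum_smul_outer_le {n : ℕ} {σ : Type*} [Fintype σ] (c : σ → K)
    (x y : σ → Fin n → K) :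
    (∑ s, c s • (Matrix.of fun i j : Fin n => x s i * y s j)).rank ≤ Fintype.card σ := by
  classical
  have hfac : (∑ s, c s • (Matrix.of fun i j : Fin n => x s i * y s j)) =
      (Matrix.of fun (i : Fin n) (s : σ) => c s * x s i) * (Matrix.of fun (s : σ) (j : Fin n) => y s j) := by
    ext i j
    simp only [Matrix.sum_apply, Matrix.smul_apply, Matrix.of_apply, smul_eq_mul, Matrix.mul_apply]
    exact Finset.sum_congr rfl fun s _ => by ring
  rw [hfac]
  exact (Matrix.rank_mul_le_left _ _).trans (Matrix.rank_le_card_width _)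

/-! ### The slices of `slicesTensor` and of a triad decomposition -/

omit [Field K] in
/-- Entries of the slices tensor. [cite: BlaserIkenmeyerJindalLysikov2018, §4] -/
theorem slicesTensor_apply {n m : ℕ} (A₀ : Matrix (Fin n) (Fin n) K)
    (A : Fin m → Matrix (Fin n) (Fin n) K) (o : Option (Fin m)) (i j : Fin n) :
    slicesTensor K A₀ A o i j = (o.elim A₀ A) i j := rfl

/-- From a triad decomposition `t = Σ_l w_l ⊗ u_l ⊗ v_l` of the slices tensor: every
`K`-combination `Σ_o g_o A_o` of the slices is `Σ_l (Σ_o g_o w_l(o)) · u_l ⊗ v_l`.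
[cite: BlaserIkenmeyerJindalLysikov2018, Thm. 18] -/
theorem sum_smul_slice_eq {n m R : ℕ} (A₀ : Matrix (Fin n) (Fin n) K)
    (A : Fin m → Matrix (Fin n) (Fin n) K) {w : Fin R → Option (Fin m) → K}
    {u v : Fin R → Fin n → K} (ht : slicesTensor K A₀ A = ∑ l, triad (w l) (u l) (v l))
    (g : Option (Fin m) → K) :
    (∑ o, g o • (o.elim A₀ A : Matrix (Fin n) (Fin n) K)) =
      ∑ l, (∑ o, g o * w l o) • (Matrix.of fun i j : Fin n => u l i * v l j) := by
  ext i j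
  have hslice : ∀ o, (o.elim A₀ A : Matrix (Fin n) (Fin n) K) i j = ∑ l, w l o * u l i * v l j := by
    intro o
    have := congr_fun (congr_fun (congr_fun ht o) i) j
    rw [slicesTensor_apply] at this
    rw [this, Finset.sum_apply, Finset.sum_apply, Finset.sum_apply]
    rfl
  simp only [Matrix.sum_apply, Matrix.smul_apply, smul_eq_mul, Matrix.of_apply, hslice,
    Finset.mul_sum, Finset.sum_mul]
  rw [Finset.sum_comm]
  exact Finset.sum_congr rfl fun l _ => Finset.sum_congr rfl fun o _ => by ring

/-- The pencil value `A₀ + Σ_k c_k A_k` is the combination of the slices with coefficient vector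
`(1, c)`. [cite: BlaserIkenmeyerJindalLysikov2018, Def. 8] -/
theorem pencilEval_eq_sum_option {n m : ℕ} (A₀ : Matrix (Fin n) (Fin n) K)
    (A : Fin m → Matrix (Fin n) (Fin n) K) (g : Option (Fin m) → K) (hg : g none = 1) :
    pencilEval A₀ A (fun k => g (some k)) = ∑ o, g o • (o.elim A₀ A : Matrix (Fin n) (Fin n) K) := by
  rw [pencilEval, Fintype.sum_option, hg, one_smul]
  rfl

end Theorem18

open Theorem18

/-! ### `R(t) ≤ CR(t) + m` -/

/-- **Upper bound** `R(t) ≤ CR(t) + m` for rank-one slices `A₁, …, A_m` (the printed argument of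
Prop. 19 without `ε`: `t = e₀ ⊗ (A₀ + Σ λ_k A_k) + Σ_k (e_k - λ_k e₀) ⊗ A_k`).
[cite: BlaserIkenmeyerJindalLysikov2018, Thm. 18 (with the proof of Prop. 19)] -/
theorem tensorRank_slicesTensor_le {n m : ℕ} (A₀ : Matrix (Fin n) (Fin n) K)
    (A : Fin m → Matrix (Fin n) (Fin n) K) (hA : ∀ k, (A k).rank = 1) :
    tensorRank (slicesTensor K A₀ A) ≤ completionRank A₀ A + m := by
  classical
  obtain ⟨c, hc⟩ := exists_rank_pencilEval_eq_completionRank A₀ A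
  set r := completionRank A₀ A with hr
  -- the optimal pencil value is a sum of `r` rank-one matrices
  obtain ⟨U, V, hUV⟩ := exists_eq_transpose_mul_of_rank_le K (pencilEval A₀ A c) hc.le
  -- each `A k` is an outer product
  have hAk : ∀ k, ∃ U₁ V₁ : Matrix (Fin 1) (Fin n) K, A k = U₁.transpose * V₁ :=
    fun k => exists_eq_transpose_mul_of_rank_le K (A k) (hA k).le
  choose U₁ V₁ hUV₁ using hAk
  -- the decomposition indexed by `Fin r ⊕ Fin m`
  have hcard : Fintype.card (Fin r ⊕ Fin m) = r + m := by simp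
  rw [← hcard]
  refine tensorRank_le_card_of_eq_sum
    (fun s : Fin r ⊕ Fin m => Sum.elim
      (fun (_ : Fin r) (o : Option (Fin m)) => if o = none then (1 : K) else 0)
      (fun (k : Fin m) (o : Option (Fin m)) =>
        (if o = some k then (1 : K) else 0) - (if o = none then c k else 0)) s)
    (fun s => Sum.elim (fun l i => U l i) (fun k i => U₁ k 0 i) s)
    (fun s => Sum.elim (fun l j => V l j) (fun k j => V₁ k 0 j) s) ?_
  -- entrywise check
  have hM : ∀ i j, A₀ i j + ∑ k, c k * A k i j = ∑ l, U l i * V l j := by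
    intro i j
    have := congr_fun (congr_fun hUV i) j
    simp only [pencilEval, Matrix.add_apply, Matrix.sum_apply, Matrix.smul_apply, smul_eq_mul,
      Matrix.mul_apply, Matrix.transpose_apply] at this
    exact this
  have hAk' : ∀ k i j, A k i j = U₁ k 0 i * V₁ k 0 j := by
    intro k i j
    have := congr_fun (congr_fun (hUV₁ k) i) j
    simp only [Matrix.mul_apply, Matrix.transpose_apply, Fin.sum_univ_one] at this
    exact this
  funext o i j
  rw [slicesTensor_apply, Finset.sum_apply, Finset.sum_apply, Finset.sum_apply,
    Fintype.sum_sum_type]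
  simp only [triad_apply, Sum.elim_inl, Sum.elim_inr]
  cases o with
  | none =>
    simp only [if_true, reduceCtorEq, if_false, zero_sub, one_mul, neg_mul]
    have key := hM i j
    simp only [hAk'] at key
    simp only [Option.elim, Finset.sum_neg_distrib, mul_assoc] at key ⊢
    linear_combination key
  | some k' =>
    simp only [reduceCtorEq, if_false, zero_mul, Finset.sum_const_zero, zero_add, sub_zero,
      Option.some.injEq]
    rw [Option.elim, hAk' k' i j, Finset.sum_eq_single k']
    · simp
    · intro k _ hk
      rw [if_neg (Ne.symm hk), zero_mul, zero_mul]
    · simp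

/-! ### `CR(t) + m ≤ R(t)` -/

/-- **Lower bound** `CR(t) + m ≤ R(t)` for linearly independent slices (no rank condition on the
`A_k` is needed for this half). [cite: BlaserIkenmeyerJindalLysikov2018, Thm. 18] -/
theorem completionRank_add_le_tensorRank {n m : ℕ} (A₀ : Matrix (Fin n) (Fin n) K)
    (A : Fin m → Matrix (Fin n) (Fin n) K)
    (hli : LinearIndependent K (fun o : Option (Fin m) => (o.elim A₀ A : Matrix (Fin n) (Fin n) K))) :
    completionRank A₀ A + m ≤ tensorRank (slicesTensor K A₀ A) := by
  classical
  set t := slicesTensor K A₀ A with htdef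
  set R := tensorRank t with hRdef
  obtain ⟨w, u, v, ht⟩ := exists_triad_decomposition_tensorRank t
  -- Step 1: the first-factor vectors `w l ∈ K^{m+1}` span everything
  have hspan : Submodule.span K (Set.range w) = ⊤ := by
    by_contra hne
    obtain ⟨f, hf0, hfker⟩ := Submodule.exists_le_ker_of_lt_top _ (lt_top_iff_ne_top.2 hne)
    have hfw : ∀ l, f (w l) = 0 := fun l =>
      LinearMap.mem_ker.1 (hfker (Submodule.subset_span ⟨l, rfl⟩))
    set g : Option (Fin m) → K := fun o => f (fun o' => if o = o' then 1 else 0) with hgdef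
    have hfg : ∀ x : Option (Fin m) → K, f x = ∑ o, x o * g o := fun x => by
      rw [LinearMap.pi_apply_eq_sum_univ f x]
      simp only [smul_eq_mul, hgdef]
    have hrel : ∑ o, g o • (o.elim A₀ A : Matrix (Fin n) (Fin n) K) = 0 := by
      rw [sum_smul_slice_eq A₀ A ht g]
      refine Finset.sum_eq_zero fun l _ => ?_
      have : ∑ o, g o * w l o = f (w l) := by
        rw [hfg]; exact Finset.sum_congr rfl fun o _ => mul_comm _ _
      rw [this, hfw l, zero_smul]
    have hg : ∀ o, g o = 0 := Fintype.linearIndependent_iff.1 hli g hrel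
    apply hf0
    refine LinearMap.ext fun x => ?_
    rw [hfg x, LinearMap.zero_apply]
    exact Finset.sum_eq_zero fun o _ => by rw [hg o, mul_zero]
  -- Step 2: a basis among the `w l`
  obtain ⟨κ, a, ha, hspan', hli'⟩ := exists_linearIndependent' (K := K) w
  haveI : Finite κ := Finite.of_injective a ha
  letI : Fintype κ := Fintype.ofFinite κ
  have htop : ⊤ ≤ Submodule.span K (Set.range (w ∘ a)) := by rw [hspan', hspan]
  let b : Module.Basis κ K (Option (Fin m) → K) := Module.Basis.mk hli' htop
  have hb : ∀ k, b k = w (a k) := fun k => Module.Basis.mk_apply hli' htop k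
  have hcardκ : Fintype.card κ = m + 1 := by
    have h1 := Module.finrank_eq_card_basis b
    rw [Module.finrank_fintype_fun_eq_card, Fintype.card_option, Fintype.card_fin] at h1
    exact h1.symm
  -- Step 3: a coordinate form not vanishing at `e₀`
  set e : Option (Fin m) → K := fun o => if o = none then 1 else 0 with hedef
  have he0 : e ≠ 0 := fun h => by
    have := congr_fun h none
    simp [hedef] at this
  obtain ⟨k₀, hk₀⟩ : ∃ k₀, b.repr e k₀ ≠ 0 :=
    not_forall.1 fun hall => he0 (b.repr.map_eq_zero_iff.1 (Finsupp.ext hall))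
  -- the normalised form `π` with `π e = 1`, `π (w (a k)) = 0` for `k ≠ k₀`
  set π : (Option (Fin m) → K) →ₗ[K] K := (b.repr e k₀)⁻¹ • b.coord k₀ with hπdef
  have hπe : π e = 1 := by
    rw [hπdef, LinearMap.smul_apply, Module.Basis.coord_apply, smul_eq_mul, inv_mul_cancel₀ hk₀]
  have hπb : ∀ k, k ≠ k₀ → π (w (a k)) = 0 := by
    intro k hk
    rw [hπdef, LinearMap.smul_apply, Module.Basis.coord_apply, ← hb, Module.Basis.repr_self,
      Finsupp.single_eq_of_ne hk.symm, smul_zero]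
  -- Step 4: the pencil point `λ_k = π(e_k)`
  set g : Option (Fin m) → K := fun o => π (fun o' => if o = o' then 1 else 0) with hgdef
  have hπx : ∀ x : Option (Fin m) → K, π x = ∑ o, x o * g o := fun x => by
    rw [LinearMap.pi_apply_eq_sum_univ π x]
    simp only [smul_eq_mul, hgdef]
  have hgnone : g none = 1 := by
    rw [← hπe]
    simp only [hgdef]
    congr 1
    funext o'
    cases o' <;> simp [hedef]
  have hpencil : pencilEval A₀ A (fun k => g (some k)) =
      ∑ l, π (w l) • (Matrix.of fun i j : Fin n => u l i * v l j) := by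
    rw [pencilEval_eq_sum_option A₀ A g hgnone, sum_smul_slice_eq A₀ A ht g]
    refine Finset.sum_congr rfl fun l _ => ?_
    rw [hπx (w l)]
    congr 1
    exact Finset.sum_congr rfl fun o _ => mul_comm _ _
  -- Step 5: at most `R - m` nonzero terms
  set S : Finset (Fin R) := Finset.univ.filter fun l => π (w l) ≠ 0 with hSdef
  set T : Finset (Fin R) := (Finset.univ.erase k₀).image a with hTdef
  have hTcard : T.card = m := by
    rw [hTdef, Finset.card_image_of_injective _ ha, Finset.card_erase_of_mem (Finset.mem_univ _),
      Finset.card_univ, hcardκ, Nat.add_sub_cancel]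
  have hST : S ⊆ Finset.univ \ T := by
    intro l hl
    rw [Finset.mem_sdiff]
    refine ⟨Finset.mem_univ _, fun hlT => ?_⟩
    rw [hTdef, Finset.mem_image] at hlT
    obtain ⟨k, hk, rfl⟩ := hlT
    rw [hSdef, Finset.mem_filter] at hl
    exact hl.2 (hπb k (Finset.ne_of_mem_erase hk))
  have hScard : S.card ≤ R - m := by
    refine (Finset.card_le_card hST).trans ?_
    rw [Finset.card_sdiff_of_subset (Finset.subset_univ T), Finset.card_univ, Fintype.card_fin,
      hTcard]
  have hmR : m ≤ R := by
    have := Finset.card_le_univ T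
    rw [Fintype.card_fin, hTcard] at this
    exact this
  -- Step 6: the rank estimate
  have hrank : (pencilEval A₀ A (fun k => g (some k))).rank ≤ R - m := by
    rw [hpencil]
    have hsum : (∑ l, π (w l) • (Matrix.of fun i j : Fin n => u l i * v l j)) =
        ∑ l ∈ S, π (w l) • (Matrix.of fun i j : Fin n => u l i * v l j) := by
      rw [hSdef, Finset.sum_filter]
      refine Finset.sum_congr rfl fun l _ => ?_
      split_ifs with h
      · rfl
      · rw [not_not.1 h, zero_smul]
    rw [hsum, ← Finset.sum_coe_sort S]
    exact (rank_sum_smul_outer_le (σ := ↥S) (fun s => π (w s)) (fun s => u s) (fun s => v s)).trans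
      (by rw [Fintype.card_coe]; exact hScard)
  have hCR := (completionRank_le A₀ A (fun k => g (some k))).trans hrank
  omega

/-! ### Theorem 18 -/

variable (K) in
/-- **BIJL 2018, Theorem 18 holds** (essentially Derksen): for linearly independent slices
`A₀, A₁, …, A_m` with `rk A₁ = ⋯ = rk A_m = 1`, `R(t) = CR(t) + m`. Discharge of the named fact
`BIJL2018_thm18`. [cite: BlaserIkenmeyerJindalLysikov2018, Thm. 18] -/
theorem BIJL2018_thm18_holds : BIJL2018_thm18 K := by
  intro n m A₀ A hli hA
  exact le_antisymm (tensorRank_slicesTensor_le A₀ A hA) (completionRank_add_le_tensorRank A₀ A hli)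

end Literature.Barriers.ValiantsHypothesis

end
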